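import Mathlib
import Summits.RiemannHypothesis.RiemannHypothesis.Theorems.WeilFarCoercivityFloor
import HarnessLib

/-!
# The prime-shift form is `L²`-Lipschitz on a window

Helper file (`--supports stmt-RiemannHypothesis-0098`, lead-track anchor: Weil-positivity window ladder, format-C far bound),
pure proofs, RH-free.  Seat rh-explicit-weil-1 gen11 (memo `run/shared/lean/pub/rh-explicit/rh-explicit-weil-1/FORMAT-K3.md` §12.6).
For admissible `u, v` on `[−a, a]` (real, measurable, bounded by a common `C`, vanishing off the window):

  `|Q_a(u) − Q_a(v)| ≤ (Σ_{log n < 2a} 2Λ(n)/√n) · ‖u − v‖₂ · (‖u‖₂ + ‖v‖₂)`   (`abs_primeShiftForm_sub_le`),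

from the per-shift bound `|∫u(x−ℓ)u(x) − ∫v(x−ℓ)v(x)| ≤ ‖u − v‖₂(‖u‖₂ + ‖v‖₂)` (`abs_integral_shift_mul_sub_le`) and the elementary
Cauchy–Schwarz inequality `(∫fg)² ≤ ∫f²∫g²` (`sq_integral_mul_le`, discriminant proof).  Used to pass the RH anatomy of
`WeilFarFloorRHCeiling` from smooth Weil tests to admissible window functions through the mollifications of `WeilFarFloorWindowSmoothing`
(route «RH ⟹ λ_max(a) ≤ e^a + O(a)», FORMAT-K3 §12.6).  Standard axioms only.
-/

set_option linter.dupNamespace false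
set_option autoImplicit false

noncomputable section

open MeasureTheory Set Filter
open scoped Real Topology ArithmeticFunction.vonMangoldt

namespace Summit.RiemannHypothesis.RiemannHypothesis.Theorems.WeilFormatC

namespace FloorSmoothing

open Literature.NumberTheory.LFunctions

/-- Elementary Cauchy–Schwarz: `(∫ f g)² ≤ (∫ f²)(∫ g²)` for `f, g` with `f², fg, g²` integrable (discriminant of `∫(f − tg)² ≥ 0`). -/
theorem sq_integral_mul_le {f g : ℝ → ℝ} (hff : Integrable fun x ↦ f x ^ 2) (hfg : Integrable fun x ↦ f x * g x)
    (hgg : Integrable fun x ↦ g x ^ 2) :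
    (∫ x, f x * g x) ^ 2 ≤ (∫ x, f x ^ 2) * ∫ x, g x ^ 2 := by
  set A := ∫ x, f x ^ 2 with hA
  set B := ∫ x, f x * g x with hB
  set Cc := ∫ x, g x ^ 2 with hCc
  have hnn : ∀ t : ℝ, 0 ≤ A - 2 * t * B + t ^ 2 * Cc := by
    intro t
    have hpt : (fun x ↦ (f x - t * g x) ^ 2) = fun x ↦ f x ^ 2 - 2 * t * (f x * g x) + t ^ 2 * g x ^ 2 := by
      funext x; ring
    have i1 : Integrable (fun x ↦ f x ^ 2 - 2 * t * (f x * g x)) := hff.sub (hfg.const_mul _)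
    have i2 : Integrable (fun x ↦ t ^ 2 * g x ^ 2) := hgg.const_mul _
    have h0 : 0 ≤ ∫ x, (f x - t * g x) ^ 2 := integral_nonneg fun x ↦ sq_nonneg _
    rw [hpt, integral_add i1 i2, integral_sub hff (hfg.const_mul _), integral_const_mul, integral_const_mul] at h0
    rw [hA, hB, hCc]; linarith
  have hC0 : 0 ≤ Cc := integral_nonneg fun x ↦ sq_nonneg _
  rcases hC0.eq_or_lt with hC0' | hCpos
  · have hB0 : B = 0 := by
      by_contra hne
      have h1 := hnn ((A + 1) / (2 * B))
      rw [← hC0', mul_zero, add_zero] at h1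
      have h2 : 2 * ((A + 1) / (2 * B)) * B = A + 1 := by field_simp
      linarith
    rw [hB0, ← hC0']; simp
  · have h1 := hnn (B / Cc)
    have h2 : A - 2 * (B / Cc) * B + (B / Cc) ^ 2 * Cc = (A * Cc - B ^ 2) / Cc := by field_simp; ring
    rw [h2] at h1
    have := (div_nonneg_iff.1 h1)
    rcases this with ⟨h3, -⟩ | ⟨-, h4⟩
    · linarith
    · linarith

/-- Shifted products `f(x − s)·g(x − t)` of bounded measurable functions, the FIRST vanishing off `[−a, a]`, are integrable. -/
theorem integrable_shift_mul_shift_left {a : ℝ} {f g : ℝ → ℝ} {Cf Cg : ℝ} (hf : Measurable f) (hg : Measurable g)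
    (hCf : ∀ x, |f x| ≤ Cf) (hCg : ∀ x, |g x| ≤ Cg) (hfs : ∀ x, x ∉ Icc (-a) a → f x = 0) (s t : ℝ) :
    Integrable (fun x ↦ f (x - s) * g (x - t)) := by
  have hCg0 : 0 ≤ Cg := (abs_nonneg _).trans (hCg 0)
  have hdom : Integrable ((Icc (-a + s) (a + s)).indicator fun _ : ℝ ↦ Cf * Cg) :=
    (integrable_indicator_iff measurableSet_Icc).2 (integrableOn_const (by simp [Real.volume_Icc]))
  refine hdom.mono' ((hf.comp (measurable_id.sub_const s)).mul (hg.comp (measurable_id.sub_const t))).aestronglyMeasurable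
    (Eventually.of_forall fun x ↦ ?_)
  by_cases hx : x ∈ Icc (-a + s) (a + s)
  · rw [indicator_of_mem hx, Real.norm_eq_abs, abs_mul]
    exact mul_le_mul (hCf _) (hCg _) (abs_nonneg _) ((abs_nonneg _).trans (hCf 0))
  · have hxs : x - s ∉ Icc (-a) a := fun h ↦ hx ⟨by linarith [h.1], by linarith [h.2]⟩
    rw [indicator_of_notMem hx, hfs _ hxs, zero_mul, norm_zero]

/-! ## The estimates -/

/-- For admissible `u, v` on a window: `|∫ u(x−ℓ)u(x) − ∫ v(x−ℓ)v(x)| ≤ ‖u − v‖₂(‖u‖₂ + ‖v‖₂)`. -/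
theorem abs_integral_shift_mul_sub_le {a : ℝ} {u v : ℝ → ℝ} {Cu Cv : ℝ} (hu : Measurable u) (hv : Measurable v)
    (hCu : ∀ x, |u x| ≤ Cu) (hCv : ∀ x, |v x| ≤ Cv) (hus : ∀ x, x ∉ Icc (-a) a → u x = 0)
    (hvs : ∀ x, x ∉ Icc (-a) a → v x = 0) (ℓ : ℝ) :
    |(∫ x, u (x - ℓ) * u x) - ∫ x, v (x - ℓ) * v x|
      ≤ Real.sqrt (∫ x, (u x - v x) ^ 2) * (Real.sqrt (∫ x, u x ^ 2) + Real.sqrt (∫ x, v x ^ 2)) := by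
  -- the difference `d = u − v` is admissible
  have hd : Measurable (fun x ↦ u x - v x) := hu.sub hv
  have hCd : ∀ x, |u x - v x| ≤ Cu + Cv := fun x ↦ (abs_sub _ _).trans (add_le_add (hCu x) (hCv x))
  have hds : ∀ x, x ∉ Icc (-a) a → u x - v x = 0 := fun x hx ↦ by rw [hus x hx, hvs x hx, sub_zero]
  -- integrability of all pairings (shifted products of admissible functions)
  have I := fun {f g : ℝ → ℝ} {Cf Cg : ℝ} (hf : Measurable f) (hg : Measurable g) (hCf : ∀ x, |f x| ≤ Cf)
      (hCg : ∀ x, |g x| ≤ Cg) (hgs : ∀ x, x ∉ Icc (-a) a → g x = 0) (s t : ℝ) ↦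
    (show Integrable (fun x ↦ f (x - s) * g (x - t)) from
      (integrable_shift_mul_shift_left (a := a) hg hf hCg hCf hgs t s).congr
        (Eventually.of_forall fun x ↦ (by ring : g (x - t) * f (x - s) = f (x - s) * g (x - t))))
  have e1 : (∫ x, u (x - ℓ) * u x) - ∫ x, v (x - ℓ) * v x
      = (∫ x, (u (x - ℓ) - v (x - ℓ)) * u x) + ∫ x, v (x - ℓ) * (u x - v x) := by
    have i1 : Integrable (fun x ↦ (u (x - ℓ) - v (x - ℓ)) * u x) := by
      have := I hd hu hCd hCu hus ℓ 0
      exact this.congr (Eventually.of_forall fun x ↦ by simp only [sub_zero])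
    have i2 : Integrable (fun x ↦ v (x - ℓ) * (u x - v x)) := by
      have := I hv hd hCv hCd hds ℓ 0
      exact this.congr (Eventually.of_forall fun x ↦ by simp only [sub_zero])
    rw [← integral_add i1 i2]
    have i3 : Integrable (fun x ↦ u (x - ℓ) * u x) := by
      have := I hu hu hCu hCu hus ℓ 0
      exact this.congr (Eventually.of_forall fun x ↦ by simp only [sub_zero])
    have i4 : Integrable (fun x ↦ v (x - ℓ) * v x) := by
      have := I hv hv hCv hCv hvs ℓ 0
      exact this.congr (Eventually.of_forall fun x ↦ by simp only [sub_zero])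
    rw [← integral_sub i3 i4]
    refine integral_congr_ae (Eventually.of_forall fun x ↦ ?_); simp only; ring
  rw [e1]
  -- Cauchy–Schwarz on each pairing
  have sq := fun {f : ℝ → ℝ} {Cf : ℝ} (hf : Measurable f) (hCf : ∀ x, |f x| ≤ Cf) (hfs : ∀ x, x ∉ Icc (-a) a → f x = 0)
      (s : ℝ) ↦ (show Integrable (fun x ↦ f (x - s) ^ 2) from by
        have := I hf hf hCf hCf hfs s s
        exact this.congr (Eventually.of_forall fun x ↦ by simp only [pow_two]))
  have hshift : ∀ (f : ℝ → ℝ) (s : ℝ), ∫ x, f (x - s) ^ 2 = ∫ x, f x ^ 2 := fun f s ↦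
    integral_sub_right_eq_self (μ := volume) (fun x ↦ f x ^ 2) s
  have c1 : |∫ x, (u (x - ℓ) - v (x - ℓ)) * u x| ≤ Real.sqrt (∫ x, (u x - v x) ^ 2) * Real.sqrt (∫ x, u x ^ 2) := by
    have h := sq_integral_mul_le (f := fun x ↦ u (x - ℓ) - v (x - ℓ)) (g := u)
      (by have := sq hd hCd hds ℓ; simpa only using this)
      (by have := I hd hu hCd hCu hus ℓ 0; exact this.congr (Eventually.of_forall fun x ↦ by simp only [sub_zero]))
      (by have := sq hu hCu hus 0; simpa only [sub_zero] using this)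
    rw [show (∫ x, (u (x - ℓ) - v (x - ℓ)) ^ 2) = ∫ x, (u x - v x) ^ 2 from hshift (fun x ↦ u x - v x) ℓ] at h
    rw [← Real.sqrt_mul (integral_nonneg fun x ↦ sq_nonneg _)]
    exact Real.abs_le_sqrt h
  have c2 : |∫ x, v (x - ℓ) * (u x - v x)| ≤ Real.sqrt (∫ x, (u x - v x) ^ 2) * Real.sqrt (∫ x, v x ^ 2) := by
    have h := sq_integral_mul_le (f := fun x ↦ u x - v x) (g := fun x ↦ v (x - ℓ))
      (by have := sq hd hCd hds 0; simpa only [sub_zero] using this)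
      (by have := I hv hd hCv hCd hds ℓ 0
          exact this.congr (Eventually.of_forall fun x ↦ by simp only [sub_zero]; ring))
      (sq hv hCv hvs ℓ)
    rw [hshift v ℓ] at h
    rw [← Real.sqrt_mul (integral_nonneg fun x ↦ sq_nonneg _)]
    have e : ∫ x, v (x - ℓ) * (u x - v x) = ∫ x, (u x - v x) * v (x - ℓ) :=
      integral_congr_ae (Eventually.of_forall fun x ↦ by simp only; ring)
    rw [e]
    exact Real.abs_le_sqrt h
  calc |(∫ x, (u (x - ℓ) - v (x - ℓ)) * u x) + ∫ x, v (x - ℓ) * (u x - v x)|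
      ≤ |∫ x, (u (x - ℓ) - v (x - ℓ)) * u x| + |∫ x, v (x - ℓ) * (u x - v x)| := abs_add_le _ _
    _ ≤ _ := by rw [mul_add]; exact add_le_add c1 c2

/-- **The prime-shift form is `L²`-Lipschitz on a window**: for admissible `u, v` on `[−a, a]`,
`|Q_a(u) − Q_a(v)| ≤ (Σ_{log n<2a} 2Λ(n)/√n)·‖u − v‖₂·(‖u‖₂ + ‖v‖₂)`. -/
theorem abs_primeShiftForm_sub_le {a : ℝ} {u v : ℝ → ℝ} {Cu Cv : ℝ} (hu : Measurable u) (hv : Measurable v)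
    (hCu : ∀ x, |u x| ≤ Cu) (hCv : ∀ x, |v x| ≤ Cv) (hus : ∀ x, x ∉ Icc (-a) a → u x = 0)
    (hvs : ∀ x, x ∉ Icc (-a) a → v x = 0) :
    |primeShiftForm a u - primeShiftForm a v|
      ≤ (∑ n ∈ weilPrimeIndex a, 2 * ((Λ n : ℝ) / Real.sqrt n))
        * (Real.sqrt (∫ x, (u x - v x) ^ 2) * (Real.sqrt (∫ x, u x ^ 2) + Real.sqrt (∫ x, v x ^ 2))) := by
  unfold primeShiftForm
  rw [← Finset.sum_sub_distrib, Finset.sum_mul]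
  refine (Finset.abs_sum_le_sum_abs _ _).trans (Finset.sum_le_sum fun n _ ↦ ?_)
  rw [← mul_sub, abs_mul, abs_of_nonneg (mul_nonneg (by norm_num)
    (div_nonneg ArithmeticFunction.vonMangoldt_nonneg (Real.sqrt_nonneg _)))]
  exact mul_le_mul_of_nonneg_left (abs_integral_shift_mul_sub_le hu hv hCu hCv hus hvs _)
    (mul_nonneg (by norm_num) (div_nonneg ArithmeticFunction.vonMangoldt_nonneg (Real.sqrt_nonneg _)))

end FloorSmoothing

end Summit.RiemannHypothesis.RiemannHypothesis.Theorems.WeilFormatC
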